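import Literature.AlgebraicGeometry.HodgeTheory.CotangentSheafPullbackHom
import Literature.AlgebraicGeometry.Modules.PullbackAffineChart
import Literature.AlgebraicGeometry.Modules.IsoOfSectionsOnBasis
import Literature.AlgebraicGeometry.Motives.CotangentSheafAffineLocalizing
import Literature.AlgebraicGeometry.Motives.DifferentialsProofs
import HarnessLib

/-!
# `dg : g^*Ω¹_{X₁/S} ⟶ Ω¹_{X₀/S}` on affine charts: `c ⊗ da ↦ c • d(g♯a)`, and generation of `Γ(W, g^*Ω¹)`

Layer `Literature/AlgebraicGeometry/HodgeTheory`; sequel of `CotangentSheafPullbackHom.lean` (`cotangentSheaf.pullbackHom g`,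
the pull-back form of Hartshorne's `f^*Ω_{Y/Z} → Ω_{X/Z}`, II Prop. 8.11, for a morphism `g : X₀ ⟶ X₁` of `S`-schemes).
Everything PROVED; theorems only (no `def`, no named fact, no instance, no notation).

For opens `W ⊆ g⁻¹V` and the RESTRICTED pulled-back forms `η(ω)|_W ∈ Γ(W, g^*Ω¹_{X₁})`
(`Modules/PullbackAffineChart.unitSectionLE`):

* `cotangentSheaf.pullbackHom_app_unitSectionLE` — `dg(η(ω)|_W) = (g^♯ω)|_W`;
  `cotangentSheaf.pullbackHom_app_unitSectionLE_dSection` — `dg(η(da)|_W) = d(g♯_{V→W} a)` (`Scheme.Hom.appLE`);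
  **`cotangentSheaf.pullbackHom_app_smul_unitSectionLE_dSection`** — `dg(c • η(da)|_W) = c • d(g♯_{V→W} a)`;
* **`cotangentSheaf.pullbackHom_app_chartSectionsEquiv_tmul`** — THE CHART FORMULA: through the chart equivalence
  `Γ(W) ⊗_{Γ(V)} Γ(V, Ω¹_{X₁}) ≃ Γ(W, g^*Ω¹_{X₁})` of `Modules/PullbackAffineChart.chartSectionsEquiv` (`W`, `V` affine; `Ω¹` is
  affine-localizing, `Motives/CotangentSheafAffineLocalizing.isAffineLocalizing_cotangentSheaf`), `dg` is `c ⊗ da ↦ c • d(g♯a)`,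
  i.e. Mathlib's base-change map of Kähler differentials `KaehlerDifferential.mapBaseChange` (`B ⊗_A Ω_{A/S} → Ω_{B/S}`, the first
  map of the first fundamental exact sequence) read in the sheaves (Hartshorne II Prop. 8.11 with II Prop. 5.2 (e): `f^*(M~) = (B ⊗_A M)~`);
* `span_range_dSection_eq_top` — on an affine open `V`, `Γ(V, Ω¹_{X/S})` is spanned over `Γ(V, 𝒪)` by the `da`
  (II Remark 8.9.2: `Γ(V, Ω¹) = Ω_{Γ(V)/S}`, the tree's `bijective_toCotangentSheaf_app_holds`; `Ω_{B/S} = B·dB`);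
* **`span_range_unitSectionLE_dSection_eq_top`** — for affine `W ⊆ g⁻¹V`, **`Γ(W, g^*Ω¹_{X₁/S})` is spanned over `Γ(W, 𝒪_{X₀})`
  by the `η(da)|_W`, `a ∈ Γ(V, 𝒪_{X₁})`**.

These are the sectionwise inputs of the product formula `pr₁^*Ω¹_X ⊕ pr₂^*Ω¹_Y ≅ Ω¹_{X ×_S Y}` on the product charts
(cell `pub-hodge-ring2`, crux stmt-HodgeConjecture-26512, route BLR-absolute for `Motives.Mumford1970_cotangentSheaf_abelianVariety_free`,
captain's step map «F2-pre (c)»); research route conditional on HC_CM; not a corollary.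

## References

* R. Hartshorne, *Algebraic Geometry*, GTM 52 (1977), II Prop. 8.11, II Remark 8.9.2, II Prop. 5.2 (e), II §5 p. 110. [Hartshorne1977]
* U. Görtz, T. Wedhorn, *Algebraic Geometry I* (2nd ed. 2020), Prop. 7.24 (2) (sections of `f^*M` on affine charts). [GortzWedhorn2020]
-/

noncomputable section

-- `TopCat.Presheaf`/`Scheme.Modules` are not reducible (as in Mathlib's `AlgebraicGeometry/Modules/Sheaf.lean`).
set_option backward.isDefEq.respectTransparency false

open CategoryTheory CategoryTheory.Limits AlgebraicGeometry Opposite TopologicalSpace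

universe u

namespace Literature.AlgebraicGeometry.HodgeTheory

open Literature.AlgebraicGeometry.Modules Literature.AlgebraicGeometry.Motives

section Charts

open scoped ChangeOfRings

variable {S : Type u} [CommRing S] {X₀ X₁ : Over (Spec (CommRingCat.of S))} (g : X₀ ⟶ X₁)

/-- `dg(η(ω)|_W) = (g^♯ω)|_W` for an open `W ⊆ g⁻¹V` and a `1`-form `ω ∈ Γ(V, Ω¹_{X₁})`.
[cite: Hartshorne1977, II Prop. 8.11 (the first map f^*Ω_{Y/Z} → Ω_{X/Z})] -/
theorem cotangentSheaf.pullbackHom_app_unitSectionLE {V : X₁.left.Opens} {W : X₀.left.Opens}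
    (i : W ≤ g.left ⁻¹ᵁ V) (ω : Γ(cotangentSheaf X₁, V)) :
    (cotangentSheaf.pullbackHom g).app W (unitSectionLE g.left (cotangentSheaf X₁) i ω) =
      (cotangentSheaf X₀).presheaf.map (homOfLE i).op ((cotangentSheaf.comap g).app V ω) := by
  rw [unitSectionLE, app_presheaf_map, cotangentSheaf.pullbackHom_app_unitSection]

/-- **`dg(η(da)|_W) = d(g♯_{V→W} a)`** for an open `W ⊆ g⁻¹V` and a local function `a ∈ Γ(V, 𝒪_{X₁})`
(`g♯_{V→W} = Scheme.Hom.appLE`). [cite: Hartshorne1977, II Prop. 8.11 (the first map f^*Ω_{Y/Z} → Ω_{X/Z})] -/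
theorem cotangentSheaf.pullbackHom_app_unitSectionLE_dSection {V : X₁.left.Opens} {W : X₀.left.Opens}
    (i : W ≤ g.left ⁻¹ᵁ V) (a : Γ(X₁.left, V)) :
    (cotangentSheaf.pullbackHom g).app W (unitSectionLE g.left (cotangentSheaf X₁) i (dSection X₁ V a)) =
      dSection X₀ W (g.left.appLE V W i a) := by
  rw [cotangentSheaf.pullbackHom_app_unitSectionLE, comap_app_dSection, map_dSection]
  rfl

/-- **`dg(c • η(da)|_W) = c • d(g♯_{V→W} a)`** — the formula `c ⊗ da ↦ c • d(g♯a)` of the base-change map of Kähler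
differentials (Mathlib `KaehlerDifferential.mapBaseChange_tmul`), in the sheaf `g^*Ω¹_{X₁/S}`.
[cite: Hartshorne1977, II Prop. 8.11 (the first map f^*Ω_{Y/Z} → Ω_{X/Z})] -/
theorem cotangentSheaf.pullbackHom_app_smul_unitSectionLE_dSection {V : X₁.left.Opens} {W : X₀.left.Opens}
    (i : W ≤ g.left ⁻¹ᵁ V) (c : Γ(X₀.left, W)) (a : Γ(X₁.left, V)) :
    (cotangentSheaf.pullbackHom g).app W (c • unitSectionLE g.left (cotangentSheaf X₁) i (dSection X₁ V a)) =
      c • dSection X₀ W (g.left.appLE V W i a) := by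
  rw [Scheme.Modules.Hom.app_smul, cotangentSheaf.pullbackHom_app_unitSectionLE_dSection]

/-- **The chart formula**: through the chart equivalence `Γ(W) ⊗_{Γ(V)} Γ(V, Ω¹_{X₁}) ≃ Γ(W, g^*Ω¹_{X₁})` of
`Modules/PullbackAffineChart.chartSectionsEquiv` (`W ⊆ g⁻¹V` affine opens; `Ω¹` is affine-localizing,
`Motives.isAffineLocalizing_cotangentSheaf`), `dg` is `c ⊗ da ↦ c • d(g♯_{V→W} a)` — Mathlib's
`KaehlerDifferential.mapBaseChange`. [cite: Hartshorne1977, II Prop. 8.11 and II Prop. 5.2 (e)] -/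
theorem cotangentSheaf.pullbackHom_app_chartSectionsEquiv_tmul {V : X₁.left.Opens} (hV : IsAffineOpen V)
    {W : X₀.left.Opens} (hW : IsAffineOpen W) (i : W ≤ g.left ⁻¹ᵁ V) (c : Γ(X₀.left, W)) (a : Γ(X₁.left, V)) :
    (cotangentSheaf.pullbackHom g).app W
        (chartSectionsEquiv g.left (cotangentSheaf X₁) hV hW i (isAffineLocalizing_cotangentSheaf X₁)
          (c ⊗ₜ[Γ(X₁.left, V), (chartHom g.left i).hom]
            (appTopRestrictFromSpecEquiv (cotangentSheaf X₁) hV (dSection X₁ V a)))) =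
      c • dSection X₀ W (g.left.appLE V W i a) := by
  set p := appTopRestrictFromSpecEquiv (cotangentSheaf X₁) hV (dSection X₁ V a) with hp
  have h1 : (c ⊗ₜ[Γ(X₁.left, V), (chartHom g.left i).hom] p : chartTensor g.left (cotangentSheaf X₁) hV i) =
      c • ((1 : Γ(X₀.left, W)) ⊗ₜ[Γ(X₁.left, V), (chartHom g.left i).hom] p :
        chartTensor g.left (cotangentSheaf X₁) hV i) := by
    conv_lhs => rw [← mul_one c]
    rfl
  rw [h1, chartSectionsEquiv_smul, hp, chartSectionsEquiv_one_tmul,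
    cotangentSheaf.pullbackHom_app_smul_unitSectionLE_dSection]

/-- **On an affine open `V`, `Γ(V, Ω¹_{X/S})` is spanned over `Γ(V, 𝒪_X)` by the exact forms `da`** (`Γ(V, Ω¹) =
Ω_{Γ(V)/S}`, the tree's `bijective_toCotangentSheaf_app_holds`, and `Ω_{B/S}` is spanned by `dB`, Mathlib
`KaehlerDifferential.span_range_derivation`). [cite: Hartshorne1977, II Remark 8.9.2 and II.8 p. 172] -/
theorem span_range_dSection_eq_top (X : Over (Spec (CommRingCat.of S))) {V : X.left.Opens} (hV : IsAffineOpen V) :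
    Submodule.span Γ(X.left, V) (Set.range (dSection X V)) = ⊤ := by
  letI algV : Algebra S Γ(X.left, V) := (((constToPresheaf X).app (op V)).hom : S →+* Γ(X.left, V)).toAlgebra
  rw [eq_top_iff]
  rintro x -
  obtain ⟨ξ, rfl⟩ := (bijective_toCotangentSheaf_app_holds X hV).2 x
  have hlin : ∀ (a : Γ(X.left, V)) (ζ : Ω[Γ(X.left, V)⁄S]),
      (toCotangentSheaf X).app (op V) (a • ζ) = a • (toCotangentSheaf X).app (op V) ζ :=
    fun a ζ => ((toCotangentSheaf X).app (op V)).hom.map_smul a ζ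
  have hξ : ξ ∈ Submodule.span Γ(X.left, V) (Set.range (KaehlerDifferential.D S Γ(X.left, V))) := by
    rw [KaehlerDifferential.span_range_derivation]; exact Submodule.mem_top
  induction hξ using Submodule.span_induction with
  | mem y hy =>
    obtain ⟨b, rfl⟩ := hy
    exact Submodule.subset_span ⟨b, rfl⟩
  | zero => rw [map_zero]; exact Submodule.zero_mem _
  | add y z _ _ hy hz => rw [map_add]; exact Submodule.add_mem _ hy hz
  | smul a y _ hy => rw [hlin]; exact Submodule.smul_mem _ _ hy

/-- The restricted pull-back `ω ↦ η(ω)|_W` maps the `Γ(V, 𝒪)`-span of the `da` into the `Γ(W, 𝒪)`-span of the `η(da)|_W`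
(`η(r ω)|_W = g♯r • η(ω)|_W`). [cite: Hartshorne1977, II §5 p. 110 (f^* ⊣ f_*)] -/
theorem unitSectionLE_mem_span_of_mem_span {V : X₁.left.Opens} {W : X₀.left.Opens} (i : W ≤ g.left ⁻¹ᵁ V)
    {ω : Γ(cotangentSheaf X₁, V)} (hω : ω ∈ Submodule.span Γ(X₁.left, V) (Set.range (dSection X₁ V))) :
    unitSectionLE g.left (cotangentSheaf X₁) i ω ∈
      Submodule.span Γ(X₀.left, W)
        (Set.range fun a : Γ(X₁.left, V) => unitSectionLE g.left (cotangentSheaf X₁) i (dSection X₁ V a)) := by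
  induction hω using Submodule.span_induction with
  | mem y hy =>
    obtain ⟨a, rfl⟩ := hy
    exact Submodule.subset_span ⟨a, rfl⟩
  | zero =>
    have h0 : unitSectionLE g.left (cotangentSheaf X₁) i 0 = 0 := by
      rw [unitSectionLE, unitSection, map_zero, map_zero]
    rw [h0]
    exact Submodule.zero_mem _
  | add y z _ _ hy hz => rw [unitSectionLE_add]; exact Submodule.add_mem _ hy hz
  | smul r y _ hy => rw [unitSectionLE_smul]; exact Submodule.smul_mem _ _ hy

/-- **For affine opens `W ⊆ g⁻¹V`, `Γ(W, g^*Ω¹_{X₁/S})` is spanned over `Γ(W, 𝒪_{X₀})` by the restricted pulled-back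
exact forms `η(da)|_W`, `a ∈ Γ(V, 𝒪_{X₁})`** (`Γ(W, g^*Ω¹) = Γ(W) ⊗_{Γ(V)} Γ(V, Ω¹)` by the chart equivalence of
`Modules/PullbackAffineChart` for the affine-localizing `Ω¹`, and `Γ(V, Ω¹) = Γ(V)·dΓ(V)`).
[cite: Hartshorne1977, II Prop. 5.2 (e) and II Remark 8.9.2] [cite: GortzWedhorn2020, Prop 7.24 (2)] -/
theorem span_range_unitSectionLE_dSection_eq_top {V : X₁.left.Opens} (hV : IsAffineOpen V)
    {W : X₀.left.Opens} (hW : IsAffineOpen W) (i : W ≤ g.left ⁻¹ᵁ V) :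
    Submodule.span Γ(X₀.left, W)
        (Set.range fun a : Γ(X₁.left, V) => unitSectionLE g.left (cotangentSheaf X₁) i (dSection X₁ V a)) = ⊤ := by
  rw [eq_top_iff]
  rintro x -
  obtain ⟨t, rfl⟩ :=
    (chartSectionsEquiv g.left (cotangentSheaf X₁) hV hW i (isAffineLocalizing_cotangentSheaf X₁)).surjective x
  induction t using TensorProduct.induction_on with
  | zero => rw [map_zero]; exact Submodule.zero_mem _
  | add y z hy hz => rw [map_add]; exact Submodule.add_mem _ hy hz
  | tmul c₀ p =>
    -- retype the scalar `c₀` (an element of `Γ(W)` viewed as a `Γ(V)`-module) as a section `c ∈ Γ(W, 𝒪)`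
    obtain ⟨c, rfl⟩ : ∃ c : Γ(X₀.left, W), c = c₀ := ⟨c₀, rfl⟩
    obtain ⟨ω, rfl⟩ := (appTopRestrictFromSpecEquiv (cotangentSheaf X₁) hV).surjective p
    set p := appTopRestrictFromSpecEquiv (cotangentSheaf X₁) hV ω with hp
    have h1 : (c ⊗ₜ[Γ(X₁.left, V), (chartHom g.left i).hom] p : chartTensor g.left (cotangentSheaf X₁) hV i) =
        c • ((1 : Γ(X₀.left, W)) ⊗ₜ[Γ(X₁.left, V), (chartHom g.left i).hom] p :
          chartTensor g.left (cotangentSheaf X₁) hV i) := by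
      conv_lhs => rw [← mul_one c]
      rfl
    rw [h1, chartSectionsEquiv_smul, hp, chartSectionsEquiv_one_tmul]
    refine Submodule.smul_mem _ c (unitSectionLE_mem_span_of_mem_span g i ?_)
    rw [span_range_dSection_eq_top X₁ hV]
    exact Submodule.mem_top

end Charts

end Literature.AlgebraicGeometry.HodgeTheory

end
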